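import Literature.AnabelianGeometry.SemiGraphs.WitnessIwahoriLoop
import Mathlib.Tactic.LinearCombination
import HarnessLib

/-!
# The complement calculus in the Iwahori-type witness group `P = ℤ_p ⋊ (1 + pℤ_p)`: conjugacy classes of the
# complements `T_c` and the COMPLEMENTARY-FACTOR identity `T_c · T_d = P` (`c − d ∈ ℤ_pˣ`)

Pure `ℤ_p`-algebra over abc-iut-w5-d236's `WitnessIwahoriGroup` / `WitnessIwahoriLoop` (Mochizuki,
*Semi-graphs of anabelioids*, Publ. RIMS **42** (2006), Def. 2.4 (iv) p. 26: the vertex group `P` and the branch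
subgroups `T_0`, `T_1` of the Thm-3.7 witness `IwahoriWitness.loopGraph p`). [cite: MochizukiSemiAnbd2006, Def 2.4 p.25-26]

PROOF-ONLY file (abc-iut cell, layer L3, T54 board, row «HEST-IMPOSSIBLE@Iw_p» = abc-iut-L3-lead β69 (ii), seat
abc-iut-f-177 gen 8; file (A) of two — file (B) `ArithTotalEstrangementLoopGraphBranchTransport.lean` consumes
these identities to show that total arithmetic estrangement fails at `loopGraph p` for EVERY outer action).

* `Iw.map_conj_range_bHom` — conjugates of a complement are complements of the same class, EXACTLY:
  `x · T_c · x⁻¹ = T_{(1 + p x.s) c − p x.a}` (the inclusion is w5-d236's `Iw.conj_mem_range_bHom`; equality by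
  the disjointness `T_c ∩ T_d = 1`, `c ≠ d`);
* `Iw.exists_map_conj_range_bHom_eq_of_sub_eq` — same class (`c' − c ∈ pℤ_p`) ⇒ conjugate by a translation;
* `Iw.exists_mul_eq_of_isUnit_sub` — **complements of different classes are complementary factors**:
  `P = T_c · T_d` whenever `c − d ∈ ℤ_pˣ` (`(c s + (1+ps) d t, s ∗ t) = (A, r)` solves with
  `s = (A − d r)(c − d)⁻¹`, `t = (r − s)(1 + p s)⁻¹`);
* `IwahoriWitness.isUnit_conj_label_sub` / `conj_label_sub_eq` — for the two branch coefficients `0`, `1` of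
  `loopGraph p`: different coefficients give labels differing by a UNIT from each other's class, equal ones by a
  multiple of `p`.

No definition, no new named fact; nothing here concerns the disputed corpus; no side is taken on
[IUTchIII] Cor. 3.12.
-/

noncomputable section

namespace Literature.AnabelianGeometry.SemiGraphs

/-! ### 1. The complement calculus in `P = ℤ_p ⋊ (1 + pℤ_p)` -/

namespace Iw

open IwahoriWitness

variable {p : ℕ} [Fact p.Prime]

/-- `T_c` has a non-trivial element: `b_c(1) = (c, 1) ≠ 1`. [cite: MochizukiSemiAnbd2006, Def 2.4(iv) p.26] -/
theorem bHom_one_ne_one (c : ℤ_[p]) : bHom c (⟨1⟩ : IwU p) ≠ 1 := by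
  intro h
  have := congrArg Iw.s h
  simp at this

/-- Two complements `T_c`, `T_d` sharing a non-trivial element are equal as labels: `c = d`.
[cite: MochizukiSemiAnbd2006, Def 2.4(iv) p.26] -/
theorem eq_of_mem_range_bHom_of_mem_of_ne_one {c d : ℤ_[p]} {x : Iw p} (hx : x ≠ 1)
    (hc : x ∈ (bHom c).toMonoidHom.range) (hd : x ∈ (bHom d).toMonoidHom.range) : c = d := by
  by_contra hcd
  exact hx (eq_one_of_mem_range_bHom_of_mem hcd hc hd)

/-- **Conjugates of a complement are complements of the same class, exactly**:
`x · T_c · x⁻¹ = T_{(1 + p x.s) c − p x.a}` as subgroups of `P`. [cite: MochizukiSemiAnbd2006, Def 2.4(iv) p.26] -/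
theorem map_conj_range_bHom (x : Iw p) (c : ℤ_[p]) :
    ((bHom c).toMonoidHom.range).map (MulAut.conj x).toMonoidHom =
      (bHom (w p x.s * c - (p : ℤ_[p]) * x.a)).toMonoidHom.range := by
  set c' : ℤ_[p] := w p x.s * c - (p : ℤ_[p]) * x.a with hc'
  -- the label reached by conjugating `T_{c'}` back with `x⁻¹` is `c` (disjointness of distinct complements)
  set c'' : ℤ_[p] := w p x⁻¹.s * c' - (p : ℤ_[p]) * x⁻¹.a with hc''
  have hback : c'' = c := by
    have h1 : x * bHom c ⟨1⟩ * x⁻¹ ∈ (bHom c').toMonoidHom.range :=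
      conj_mem_range_bHom c x _ ⟨⟨1⟩, rfl⟩
    have h2 : x⁻¹ * (x * bHom c ⟨1⟩ * x⁻¹) * x⁻¹⁻¹ ∈ (bHom c'').toMonoidHom.range :=
      conj_mem_range_bHom c' x⁻¹ _ h1
    have h3 : x⁻¹ * (x * bHom c ⟨1⟩ * x⁻¹) * x⁻¹⁻¹ = bHom c ⟨1⟩ := by group
    rw [h3] at h2
    exact eq_of_mem_range_bHom_of_mem_of_ne_one (bHom_one_ne_one c) h2 ⟨⟨1⟩, rfl⟩
  ext y
  constructor
  · rintro ⟨z, hz, rfl⟩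
    exact conj_mem_range_bHom c x z hz
  · intro hy
    refine ⟨x⁻¹ * y * x⁻¹⁻¹, ?_, by rw [MulEquiv.coe_toMonoidHom, MulAut.conj_apply]; group⟩
    have := conj_mem_range_bHom c' x⁻¹ y hy
    rwa [← hc'', hback] at this

/-- **Same class ⇒ conjugate**: if `c' − c = p e` then `T_{c'} = x · T_c · x⁻¹` for the translation
`x = (−e, 0)`. [cite: MochizukiSemiAnbd2006, Def 2.4(iv) p.26] -/
theorem exists_map_conj_range_bHom_eq_of_sub_eq {c c' e : ℤ_[p]} (h : c' - c = (p : ℤ_[p]) * e) :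
    ∃ x : Iw p, ((bHom c).toMonoidHom.range).map (MulAut.conj x).toMonoidHom =
      (bHom c').toMonoidHom.range := by
  refine ⟨⟨-e, 0⟩, ?_⟩
  rw [map_conj_range_bHom]
  have hlab : w p (⟨-e, 0⟩ : Iw p).s * c - (p : ℤ_[p]) * (⟨-e, 0⟩ : Iw p).a = c' := by
    simp only [w]
    linear_combination -h
  rw [hlab]

/-- **Complements of different classes are complementary factors**: if `c − d ∈ ℤ_pˣ` then
`P = T_c · T_d` — every `u ∈ P` is `t · t'` with `t ∈ T_c`, `t' ∈ T_d`.
[cite: MochizukiSemiAnbd2006, Def 2.4(iv) p.26] -/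
theorem exists_mul_eq_of_isUnit_sub {c d : ℤ_[p]} (hcd : IsUnit (c - d)) (u : Iw p) :
    ∃ t ∈ (bHom c).toMonoidHom.range, ∃ t' ∈ (bHom d).toMonoidHom.range, u = t * t' := by
  obtain ⟨i, hi⟩ := hcd.exists_right_inv
  -- `s = (u.a − d u.s)(c − d)⁻¹`, `t = (u.s − s)(1 + p s)⁻¹`
  set σ : ℤ_[p] := (u.a - d * u.s) * i with hσ
  set τ : ℤ_[p] := (u.s - σ) * winv p σ with hτ
  refine ⟨bHom c ⟨σ⟩, ⟨⟨σ⟩, rfl⟩, bHom d ⟨τ⟩, ⟨⟨τ⟩, rfl⟩, ?_⟩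
  have hw : w p σ * winv p σ = 1 := w_mul_winv p σ
  ext
  · simp only [mul_a, bHom_a, bHom_s]
    -- `c σ + (1 + p σ) d τ = c σ + d (u.s − σ) = (c − d) σ + d u.s = u.a`
    have : w p σ * (d * τ) = d * (u.s - σ) := by
      rw [hτ]; linear_combination d * (u.s - σ) * hw
    rw [this, hσ]
    linear_combination (-(u.a - d * u.s)) * hi
  · simp only [mul_s, bHom_s]
    -- `σ + τ + p σ τ = σ + (1 + p σ) τ = σ + (u.s − σ) = u.s`
    have : σ + τ + (p : ℤ_[p]) * σ * τ = σ + w p σ * τ := by simp only [w]; ring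
    rw [this, hτ]
    linear_combination (-(u.s - σ)) * hw

end Iw

namespace IwahoriWitness

variable {p : ℕ} [Fact p.Prime]

/-- The branch coefficient of `𝓛` is `0` or `1`. [cite: MochizukiSemiAnbd2006, Def 2.1 p.22] -/
theorem coeff_eq_zero_or_eq_one (b : (SemiGraph.bouquet.{0} 1).Branch) :
    coeff p b = 0 ∨ coeff p b = 1 := by
  unfold coeff; split_ifs <;> simp

/-- For two branch coefficients `c₀ ≠ c₁` of `𝓛` and any `q ∈ P`, the label of `q · T_{c₁} · q⁻¹` differs
from `c₀` by a UNIT. [cite: MochizukiSemiAnbd2006, Def 2.4(iv) p.26] -/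
theorem isUnit_conj_label_sub {b₀ b₁ : (SemiGraph.bouquet.{0} 1).Branch} (h : coeff p b₀ ≠ coeff p b₁)
    (q : Iw p) : IsUnit (w p q.s * coeff p b₁ - (p : ℤ_[p]) * q.a - coeff p b₀) := by
  rcases coeff_eq_zero_or_eq_one (p := p) b₀ with h₀ | h₀ <;>
    rcases coeff_eq_zero_or_eq_one (p := p) b₁ with h₁ | h₁
  · exact absurd (h₀.trans h₁.symm) h
  · rw [h₀, h₁]
    have : w p q.s * 1 - (p : ℤ_[p]) * q.a - 0 = w p (q.s - q.a) := by simp only [w]; ring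
    rw [this]; exact isUnit_w p _
  · rw [h₀, h₁]
    have : w p q.s * 0 - (p : ℤ_[p]) * q.a - 1 = -w p q.a := by simp only [w]; ring
    rw [this]; exact (isUnit_w p _).neg
  · exact absurd (h₀.trans h₁.symm) h

/-- For EQUAL branch coefficients the label of `q · T_c · q⁻¹` differs from `c` by a multiple of `p`.
[cite: MochizukiSemiAnbd2006, Def 2.4(iv) p.26] -/
theorem conj_label_sub_eq (c : ℤ_[p]) (q : Iw p) :
    w p q.s * c - (p : ℤ_[p]) * q.a - c = (p : ℤ_[p]) * (q.s * c - q.a) := by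
  simp only [w]; ring

end IwahoriWitness

end Literature.AnabelianGeometry.SemiGraphs
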